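import Summits.BirchSwinnertonDyer.BirchSwinnertonDyer.Theorems.RamifiedSevenEllipticUnitsLemmaXiDeuringGlue
import HarnessLib

set_option linter.dupNamespace false
set_option autoImplicit false

/-!
# Lemma Ξ, kernel side (V): (P1)/(P5) inputs for a character with the same VALUE PAIRS as the
# Deuring character (first brick of the rigidity bridge (Rig), D144 (b2))

Helper file for the K7r Value crux `EllipticUnitValueSevenOfGZK` (stmt-BirchSwinnertonDyer-19945), line
`rubin-formula-zp` v4/v4.1, stub `stub_rubinPackageSevenZp`, clauses (P1)/(P5), bridge H_Rig. The crux
binds `φ` only through `L(φ, s) = L(W, s)`; comparing Dirichlet coefficients at `ℓ` and `ℓ²` yields,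
at a good split prime `ℓ = w · (c•w)`, only the unordered PAIR `{φ(ϖ_w), φ(ϖ_{c•w})} = {ψ(ϖ_w), ψ(ϖ_{c•w})}`
for the Deuring character `ψ` (planner D141 (b), D144 (R2)). This file shows that the pair is all that
(P1)/(P5) need: in a QUADRATIC field `c² = 1`, so the swapped case is the unswapped case for the
conjugate generator `cα` (which is again prime to the ramified `𝔭`, file (III)), and
`‖ι⁻¹(φ_ac(ϖ_w)) − 1‖² ≤ p⁻¹` follows from file (IV) in both cases
(`sq_norm_φac_value_sub_one_le_of_pair`, `…_eq_of_pair`); hence (P1) for every Rubin datum over such a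
`φ` (`RubinPadicLFunctionData.galConj_η_eq_of_pairs`, `…ξ_eq_φac_of_pairs`).

References: Silverman, *Advanced Topics*, II Thm. 9.2, Cor. 10.4.1; [BKNO] arXiv:2608.06879 Def. 4.2.
-/

noncomputable section

open scoped Classical NNReal Topology Pointwise
open NumberField IsDedekindDomain Field
  Literature.NumberTheory.EllipticCurves
  Literature.NumberTheory.EllipticCurves.BurungaleKobayashiNakamuraOta2026
  Literature.NumberTheory.GaloisRepresentations

namespace Summit.BirchSwinnertonDyer.BirchSwinnertonDyer.Theorems.RamifiedSevenEllipticUnits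

namespace LemmaXi

variable {K : Type} [Field K] [NumberField K] {p : ℕ} [hp : Fact p.Prime]

/-- In a quadratic field every automorphism is an involution: `c (c x) = x`. [folklore] -/
theorem algEquiv_apply_apply_of_finrank_eq_two (h2 : Module.finrank ℚ K = 2) (c : K ≃ₐ[ℚ] K)
    (x : K) : c (c x) = x := by
  haveI : Algebra.IsQuadraticExtension ℚ K := ⟨h2⟩
  have hG : Nat.card (K ≃ₐ[ℚ] K) = 2 := by rw [IsGalois.card_aut_eq_finrank, h2]
  have hc : c ^ 2 = 1 := by
    rw [← hG]
    exact pow_card_eq_one'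
  rw [← AlgEquiv.mul_apply, ← pow_two, hc, AlgEquiv.one_apply]

/-- **The value-PAIR version of file (IV)**: if `ψ` has Deuring-shaped values at `w`, `c • w`
(`ψ(ϖ_w) = σ'(α)`, `ψ(ϖ_{c•w}) = σ'(cα)`, `α ∉ 𝔭`) and `φ` (unramified at `c • w`) has the SAME PAIR of
values, in either order, then `‖ι⁻¹(φ_ac(ϖ_w)) − 1‖² ≤ p⁻¹` (`K` quadratic, `p ∣ d_K`, `𝔭 ∋ p`).
[cite: SilvermanATAEC1994, Ch. II Cor. 10.4.1 (a) and Thm. 9.2] [cite: NeukirchANT1999, Ch. I §9 Prop. (9.6)] -/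
theorem sq_norm_φac_value_sub_one_le_of_pair (h2 : Module.finrank ℚ K = 2)
    (hdvd : (p : ℤ) ∣ NumberField.discr K) (𝔭 : HeightOneSpectrum (𝓞 K))
    (hp𝔭 : ((p : ℕ) : 𝓞 K) ∈ 𝔭.asIdeal) (c : K ≃ₐ[ℚ] K) (ι : PadicAlgCl p ≃+* ℂ) (σ' : K →+* ℂ)
    (φ ψ : HeckeCharacter K) {w : HeightOneSpectrum (𝓞 K)} {α : 𝓞 K} (hw : φ.IsUnramifiedAt (c • w))
    (hα : α ∉ 𝔭.asIdeal) (hψw : ψ.valueAtUniformizer w = σ' (α : K))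
    (hψcw : ψ.valueAtUniformizer (c • w) = σ' (c (α : K)))
    (hpair : (φ.valueAtUniformizer w = ψ.valueAtUniformizer w ∧
        φ.valueAtUniformizer (c • w) = ψ.valueAtUniformizer (c • w)) ∨
      (φ.valueAtUniformizer w = ψ.valueAtUniformizer (c • w) ∧
        φ.valueAtUniformizer (c • w) = ψ.valueAtUniformizer w)) :
    ‖((ι.symm ((φ * (HeckeCharacter.galConj c φ)⁻¹).valueAtUniformizer w) : PadicAlgCl p) : ℂ_[p])
      - 1‖ ^ 2 ≤ ((p : ℝ))⁻¹ := by
  rcases hpair with ⟨h1, h2'⟩ | ⟨h1, h2'⟩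
  · exact sq_norm_φac_value_sub_one_le h2 hdvd 𝔭 hp𝔭 c ι σ' φ hw hα (h1.trans hψw) (h2'.trans hψcw)
  · -- the swapped pair is the unswapped pair for the conjugate generator `cα`
    have hcα : c • α ∉ 𝔭.asIdeal := fun h ↦
      hα (by simpa using Ideal.sub_mem _ h (smul_sub_mem_of_dvd_discr h2 hdvd 𝔭 hp𝔭 c α))
    have hv1 : φ.valueAtUniformizer w = σ' ((c • α : 𝓞 K) : K) := h1.trans hψcw
    have hv2 : φ.valueAtUniformizer (c • w) = σ' (c ((c • α : 𝓞 K) : K)) := by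
      rw [h2', hψw]
      congr 1
      exact (algEquiv_apply_apply_of_finrank_eq_two h2 c (α : K)).symm
    exact sq_norm_φac_value_sub_one_le h2 hdvd 𝔭 hp𝔭 c ι σ' φ hw hcα hv1 hv2

/-- **Equality in the value-PAIR version** when `(cα − α)² = p·u`, `u ∉ 𝔭` (the place supplying
(P5)'s equality, e.g. `α = (1 + √−7)/2`). [cite: SilvermanATAEC1994, Ch. II Cor. 10.4.1 (a)]
[cite: NeukirchANT1999, Ch. I §9 Prop. (9.6)] -/
theorem sq_norm_φac_value_sub_one_eq_of_pair (h2 : Module.finrank ℚ K = 2)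
    (hdvd : (p : ℤ) ∣ NumberField.discr K) (𝔭 : HeightOneSpectrum (𝓞 K))
    (hp𝔭 : ((p : ℕ) : 𝓞 K) ∈ 𝔭.asIdeal) (c : K ≃ₐ[ℚ] K) (ι : PadicAlgCl p ≃+* ℂ) (σ' : K →+* ℂ)
    (φ ψ : HeckeCharacter K) {w : HeightOneSpectrum (𝓞 K)} {α u : 𝓞 K} (hw : φ.IsUnramifiedAt (c • w))
    (hα : α ∉ 𝔭.asIdeal) (hu : u ∉ 𝔭.asIdeal) (hδ : (c • α - α) ^ 2 = (p : ℕ) * u)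
    (hψw : ψ.valueAtUniformizer w = σ' (α : K))
    (hψcw : ψ.valueAtUniformizer (c • w) = σ' (c (α : K)))
    (hpair : (φ.valueAtUniformizer w = ψ.valueAtUniformizer w ∧
        φ.valueAtUniformizer (c • w) = ψ.valueAtUniformizer (c • w)) ∨
      (φ.valueAtUniformizer w = ψ.valueAtUniformizer (c • w) ∧
        φ.valueAtUniformizer (c • w) = ψ.valueAtUniformizer w)) :
    ‖((ι.symm ((φ * (HeckeCharacter.galConj c φ)⁻¹).valueAtUniformizer w) : PadicAlgCl p) : ℂ_[p])
      - 1‖ ^ 2 = ((p : ℝ))⁻¹ := by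
  rcases hpair with ⟨h1, h2'⟩ | ⟨h1, h2'⟩
  · exact sq_norm_φac_value_sub_one_eq h2 hdvd 𝔭 hp𝔭 c ι σ' φ hw hα hu hδ (h1.trans hψw)
      (h2'.trans hψcw)
  · have hcα : c • α ∉ 𝔭.asIdeal := fun h ↦
      hα (by simpa using Ideal.sub_mem _ h (smul_sub_mem_of_dvd_discr h2 hdvd 𝔭 hp𝔭 c α))
    have hcc : c • (c • α) = α := by
      apply NumberField.RingOfIntegers.ext
      exact algEquiv_apply_apply_of_finrank_eq_two h2 c (α : K)
    have hδ' : (c • (c • α) - c • α) ^ 2 = (p : ℕ) * u := by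
      rw [hcc, ← hδ, ← neg_sub, neg_sq]
    have hv1 : φ.valueAtUniformizer w = σ' ((c • α : 𝓞 K) : K) := h1.trans hψcw
    have hv2 : φ.valueAtUniformizer (c • w) = σ' (c ((c • α : 𝓞 K) : K)) := by
      rw [h2', hψw]
      congr 1
      exact (algEquiv_apply_apply_of_finrank_eq_two h2 c (α : K)).symm
    exact sq_norm_φac_value_sub_one_eq h2 hdvd 𝔭 hp𝔭 c ι σ' φ hw hcα hu hδ' hv1 hv2

end LemmaXi

/-! ## (P1) for a Rubin datum over a `φ` with Deuring value PAIRS -/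

section Datum

open LemmaXi

variable {W : WeierstrassCurve ℚ} [W.IsElliptic] {p : ℕ} [hp : Fact p.Prime]
  {K : Type} [Field K] [NumberField K] {c : K ≃ₐ[ℚ] K} {𝔭 : HeightOneSpectrum (𝓞 K)}
  {κ : ZpExtension K p} {γ : absoluteGaloisGroup K} {ι : PadicAlgCl p ≃+* ℂ} {φ : HeckeCharacter K}
  {Ω : ℂ} {𝓔 : AcDualExpSystem W p K 𝔭 κ ι} {D : EllipticUnitClassData W p K 𝔭 κ γ ι φ Ω 𝓔}

/-- **LEMMA Ξ for a character with the Deuring value PAIRS** (bridge H_Rig reduced to (R2)): if off a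
finite set of finite places `φ` is unramified at `w`, `c • w` and its values at `(w, c•w)` are those of a
character `ψ` with Deuring-shaped values (`ψ(ϖ_w) = σ'(α_w)`, `ψ(ϖ_{c•w}) = σ'(cα_w)`, `α_w ∉ 𝔭`), in
either order, then `HeckeCharacter.galConj c R.η = R.η` for every Rubin datum `R` over `φ` (`K` quadratic,
`p ∣ d_K`, `𝔭 ∋ p`). [cite: BurungaleKobayashiNakamuraOta2026, Def. 4.2 (arXiv:2608.06879 p. 24) (claim; preprint; fields of the datum)]
[cite: SilvermanATAEC1994, Ch. II Cor. 10.4.1 (a) and Thm. 9.2] -/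
theorem RubinPadicLFunctionData.galConj_η_eq_of_pairs (R : RubinPadicLFunctionData W p K c 𝔭 κ γ ι φ Ω 𝓔 D)
    (h2 : Module.finrank ℚ K = 2) (hdvd : (p : ℤ) ∣ NumberField.discr K)
    (hp𝔭 : ((p : ℕ) : 𝓞 K) ∈ 𝔭.asIdeal) (σ' : K →+* ℂ) (ψ : HeckeCharacter K)
    (hφ : ∃ S : Set (HeightOneSpectrum (𝓞 K)), S.Finite ∧ ∀ w ∉ S,
      φ.IsUnramifiedAt w ∧ φ.IsUnramifiedAt (c • w) ∧ ∃ α : 𝓞 K, α ∉ 𝔭.asIdeal ∧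
        ψ.valueAtUniformizer w = σ' (α : K) ∧ ψ.valueAtUniformizer (c • w) = σ' (c (α : K)) ∧
        ((φ.valueAtUniformizer w = ψ.valueAtUniformizer w ∧
            φ.valueAtUniformizer (c • w) = ψ.valueAtUniformizer (c • w)) ∨
          (φ.valueAtUniformizer w = ψ.valueAtUniformizer (c • w) ∧
            φ.valueAtUniformizer (c • w) = ψ.valueAtUniformizer w))) :
    HeckeCharacter.galConj c R.η = R.η := by
  obtain ⟨S, hS, hS'⟩ := hφ
  have hp1 : ((p : ℝ))⁻¹ < 1 := inv_lt_one_of_one_lt₀ (by exact_mod_cast hp.out.one_lt)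
  refine RubinPadicLFunctionData.galConj_η_eq R ⟨S, hS, fun w hw ↦ ?_⟩
  obtain ⟨hunr, hunrc, α, hα, hψw, hψcw, hpair⟩ := hS' w hw
  refine ⟨hunr.mul' ((HeckeCharacter.isUnramifiedAt_galConj_iff c φ w).mpr hunrc).inv', ?_⟩
  exact norm_lt_one_of_sq_le
    (sq_norm_φac_value_sub_one_le_of_pair h2 hdvd 𝔭 hp𝔭 c ι σ' φ ψ hunrc hα hψw hψcw hpair) hp1

/-- **(P1) for a character with the Deuring value pairs**: `R.ξ = φ(φ∘c)⁻¹` under the hypotheses of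
`galConj_η_eq_of_pairs`. [cite: BurungaleKobayashiNakamuraOta2026, Def. 4.2 (arXiv:2608.06879 p. 24) (claim; preprint; fields of the datum)] -/
theorem RubinPadicLFunctionData.ξ_eq_φac_of_pairs (R : RubinPadicLFunctionData W p K c 𝔭 κ γ ι φ Ω 𝓔 D)
    (h2 : Module.finrank ℚ K = 2) (hdvd : (p : ℤ) ∣ NumberField.discr K)
    (hp𝔭 : ((p : ℕ) : 𝓞 K) ∈ 𝔭.asIdeal) (σ' : K →+* ℂ) (ψ : HeckeCharacter K)
    (hφ : ∃ S : Set (HeightOneSpectrum (𝓞 K)), S.Finite ∧ ∀ w ∉ S,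
      φ.IsUnramifiedAt w ∧ φ.IsUnramifiedAt (c • w) ∧ ∃ α : 𝓞 K, α ∉ 𝔭.asIdeal ∧
        ψ.valueAtUniformizer w = σ' (α : K) ∧ ψ.valueAtUniformizer (c • w) = σ' (c (α : K)) ∧
        ((φ.valueAtUniformizer w = ψ.valueAtUniformizer w ∧
            φ.valueAtUniformizer (c • w) = ψ.valueAtUniformizer (c • w)) ∨
          (φ.valueAtUniformizer w = ψ.valueAtUniformizer (c • w) ∧
            φ.valueAtUniformizer (c • w) = ψ.valueAtUniformizer w))) :
    R.ξ = φ * (HeckeCharacter.galConj c φ)⁻¹ :=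
  R.ξ_eq_of_galConj_η_eq (RubinPadicLFunctionData.galConj_η_eq_of_pairs R h2 hdvd hp𝔭 σ' ψ hφ)

end Datum

end Summit.BirchSwinnertonDyer.BirchSwinnertonDyer.Theorems.RamifiedSevenEllipticUnits

end
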